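import Mathlib
import HarnessLib
import Literature.MathematicalPhysics.QuantumLattice.FermiRG.BGM2003Sectors
import Summits.HubbardSuperconductivity.HubbardSuperconductivity.Theorems.KLProgrammeThinLevelSetPolarGraph

/-!
# Route `KLProgramme` — K3 engine (stmt-HubbardSuperconductivity-20437), stub (b) (ℓ)/(I2)–(I3), located item «ABS-UMK-COUNT» / «UV-REMEASURE-COUNT»:
# lattice points in thin level sets, part 9 — the POLAR GRAPH CHART OF BGM 2003's FERMI CURVE (discharging part 7 from `DispersionHyp`)

Cell gate-hubbard-kl, seat p4 g15.  For a dispersion relation satisfying BGM 2003 §1.2 (`FermiRG.BGM2003.DispersionHyp ε μ e₀ u`) the Fermi curve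
`p⃗_F(θ) = u(θ,0)·e⃗_r(θ)` (`BGM2003.fermiPoint`) is a uniformly convex smooth polar curve, so part 7 (`exists_polar_graph`) applies at EVERY base angle
`θ⋆` in the polar frame `(e⃗_t(θ⋆), e⃗_r(θ⋆))` (frame angle `α⋆ = θ⋆`, where the tangential velocity component is `u(θ⋆,0) ≥ c_u`), with constants
INDEPENDENT of `θ⋆`:

* `periodic_bound'`, `periodic_deriv'`, `contDiff_fermiRadius`, `curvatureNumerator_ge_of_dispersionHyp` — the bounds on `u, u′, u″` and the floor
  `u² + 2u′² − u·u″ = (1/r)·s′³ ≥ c·c_u³` extracted from `DispersionHyp` (fields `smooth_u`, `periodic_u`, `u_pos`, `convex`);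
* **`exists_fermiChart_of_dispersionHyp`** — `∃ s₁ Φ c_f A_f B_f M₁` (`0 < s₁ ≤ M₁`, `0 < Φ`, `0 < c_f ≤ A_f`, `0 ≤ B_f`) such that for every `θ⋆` there are
  `f, f′, f″`, `f` measurable, with `f(U_{θ⋆} φ) = V_{θ⋆} φ` for `|φ| ≤ Φ` (`U_{θ⋆} φ = (p⃗_F(θ⋆+φ) − p⃗_F(θ⋆))·e⃗_t(θ⋆)`, `V_{θ⋆} φ = −(p⃗_F(θ⋆+φ) − p⃗_F(θ⋆))·e⃗_r(θ⋆)`),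
  derivatives and bounds `c_f ≤ f″ ≤ A_f`, `|f′| ≤ B_f` on `|y| ≤ s₁Φ/4`, `U_{θ⋆}` bi-Lipschitz on `[−Φ, Φ]` with constants `s₁/2, M₁`, and `U_{θ⋆} 0 = 0`.

This is the θ⋆-UNIFORM chart package the narrow-bundle count of «ABS-UMK-COUNT» consumes; the frame-uniform twin (constants uniform over the
programme's frames `K`) is the same argument run on `…PerturbedFermiRadiusCurvature/Accel` and is left to the keyed plumbing.
Everything is PROVED; no definitions, no named facts. [cite: BenfattoGiulianiMastropietro2003, §1.2 (2.8a) and §7.1 (A1.1)–(A1.7)]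
-/

noncomputable section

open Real Set Filter Topology
open Literature.MathematicalPhysics.QuantumLattice Literature.MathematicalPhysics.QuantumLattice.FermiRG
open Literature.MathematicalPhysics.QuantumLattice.FermiRG.BGM2003

namespace Summit.HubbardSuperconductivity.HubbardSuperconductivity.Theorems.ThinLevelSet

set_option linter.dupNamespace false -- summit = problem name (single-conjunct summit), D-0017

variable {ε : (Fin 2 → ℝ) → ℝ} {μ e₀ : ℝ} {u : ℝ → ℝ → ℝ}

/-! ## §1 Regularity and bounds of the Fermi radius extracted from `DispersionHyp` -/

/-- A continuous `2π`-periodic real function is bounded (file-private brick of `BGM2003Sectors`, repeated). [folklore] -/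
theorem periodic_bound' {g : ℝ → ℝ} (hg : Continuous g) (hp : Function.Periodic g (2 * π)) :
    ∃ M : ℝ, 0 ≤ M ∧ ∀ θ : ℝ, |g θ| ≤ M := by
  obtain ⟨C, hC⟩ := isBounded_iff_forall_norm_le.1 (hp.isBounded_of_continuous (by positivity) hg)
  refine ⟨max C 0, le_max_right _ _, fun θ => ?_⟩
  exact (Real.norm_eq_abs _ ▸ hC (g θ) ⟨θ, rfl⟩).trans (le_max_left _ _)

/-- The derivative of a `2π`-periodic function is `2π`-periodic (file-private brick of `BGM2003Sectors`, repeated). [folklore] -/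
theorem periodic_deriv' {g : ℝ → ℝ} (hp : Function.Periodic g (2 * π)) :
    Function.Periodic (deriv g) (2 * π) := by
  intro θ
  have h : (fun x => g (x + 2 * π)) = g := funext hp
  rw [← deriv_comp_add_const g (2 * π) θ, h]

/-- The Fermi radius `θ ↦ u(θ,0)` is `C^∞`. [cite: BenfattoGiulianiMastropietro2003, §1.2 item 1 p.4 (L97–105)] -/
theorem contDiff_fermiRadius (hD : DispersionHyp ε μ e₀ u) : ContDiff ℝ ((⊤ : ℕ∞) : WithTop ℕ∞) (fun θ => u θ 0) := by
  obtain ⟨e₁, he₁, hsm⟩ := hD.smooth_u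
  have he₀ := hD.e₀_pos
  have hmem : ∀ θ : ℝ, (θ, (0 : ℝ)) ∈ univ ×ˢ Ioo (-e₁) e₁ := fun θ =>
    ⟨mem_univ _, ⟨by linarith, by linarith⟩⟩
  exact hsm.comp_contDiff (contDiff_id.prodMk contDiff_const) hmem

/-- The curvature numerator of the Fermi curve is bounded below: `u² + 2u′² − u u″ ≥ c·c_u³` where `c` is the curvature floor (2.8a) and `c_u` the
radius floor of `DispersionHyp` (`1/r = (u² + 2u′² − uu″)/s′³`, `s′ ≥ u ≥ c_u`). [cite: BenfattoGiulianiMastropietro2003, §1.2 (2.8a) p.4 (L106) and §7.1 (A1.7) p.26 (L45–52)] -/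
theorem curvatureNumerator_ge_of_dispersionHyp (hD : DispersionHyp ε μ e₀ u) {c cu : ℝ} (hc : 0 < c)
    (hconv : ∀ θ e : ℝ, |e| ≤ e₀ → c ≤ curvature u θ e) (hcu : 0 < cu) (hupos : ∀ θ e : ℝ, |e| ≤ e₀ → cu ≤ u θ e) (θ : ℝ) :
    c * cu ^ 3 ≤ u θ 0 ^ 2 + 2 * radiusDeriv u θ 0 ^ 2 - u θ 0 * radiusDeriv₂ u θ 0 := by
  have h0 : |(0 : ℝ)| ≤ e₀ := by rw [abs_zero]; exact hD.e₀_pos.le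
  have hu := hupos θ 0 h0
  have hupos' : 0 < u θ 0 := hcu.trans_le hu
  have hs : u θ 0 ≤ speed u θ 0 := by
    rw [speed]
    calc u θ 0 = Real.sqrt (u θ 0 ^ 2) := (Real.sqrt_sq hupos'.le).symm
      _ ≤ Real.sqrt (radiusDeriv u θ 0 ^ 2 + u θ 0 ^ 2) := Real.sqrt_le_sqrt (by nlinarith)
  have hspos : 0 < speed u θ 0 := hupos'.trans_le hs
  have hκ := hconv θ 0 h0
  rw [curvature, le_div_iff₀ (pow_pos hspos 3)] at hκ
  have h3 : cu ^ 3 ≤ speed u θ 0 ^ 3 := pow_le_pow_left₀ hcu.le (hu.trans hs) 3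
  calc c * cu ^ 3 ≤ c * speed u θ 0 ^ 3 := mul_le_mul_of_nonneg_left h3 hc.le
    _ ≤ _ := hκ

/-! ## §2 The chart package at every base angle, with θ⋆-uniform constants -/

/-- `p⃗_F(θ) = u(θ,0)·e⃗_r(θ)`. [cite: BenfattoGiulianiMastropietro2003, §7.1 (A1.1) p.26 (L21)] -/
theorem fermiPoint_eq_smul_dir (u : ℝ → ℝ → ℝ) (θ : ℝ) : fermiPoint u θ = u θ 0 • dir θ := rfl

/-- **The polar graph chart of BGM 2003's Fermi curve, uniformly in the base angle.**  Under `DispersionHyp ε μ e₀ u` there are constants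
`s₁, Φ, c_f, A_f, B_f, M₁` with `0 < s₁ ≤ M₁`, `0 < Φ`, `0 < c_f ≤ A_f`, `0 ≤ B_f` such that for EVERY base angle `θ⋆`, writing
`U φ = (p⃗_F(θ⋆+φ) − p⃗_F(θ⋆))·e⃗_t(θ⋆)` and `V φ = −(p⃗_F(θ⋆+φ) − p⃗_F(θ⋆))·e⃗_r(θ⋆)`, there are `f, f′, f″ : ℝ → ℝ`, `f` measurable, with:
`f(U φ) = V φ` for `|φ| ≤ Φ`; `HasDerivAt f (f′ y) y`, `HasDerivAt f′ (f″ y) y`, `c_f ≤ f″ y ≤ A_f`, `|f′ y| ≤ B_f` for `|y| ≤ s₁Φ/4`;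
`(s₁/2)|φ − φ′| ≤ |U φ − U φ′| ≤ M₁|φ − φ′|` on `[−Φ, Φ]`; `U 0 = 0`. [cite: BenfattoGiulianiMastropietro2003, §1.2 (2.8a) p.4 (L106) and §7.1 (A1.1)–(A1.7) p.26 (L16–52)] -/
theorem exists_fermiChart_of_dispersionHyp (hD : DispersionHyp ε μ e₀ u) :
    ∃ s₁ Φ cf Af Bf M₁ : ℝ, 0 < s₁ ∧ s₁ ≤ M₁ ∧ 0 < Φ ∧ 0 < cf ∧ cf ≤ Af ∧ 0 ≤ Bf ∧
      ∀ θs : ℝ, ∃ f f' f'' : ℝ → ℝ, Measurable f ∧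
        (∀ φ ∈ Icc (-Φ) Φ,
          f ((fermiPoint u (θs + φ) - fermiPoint u θs) ⬝ᵥ tdir θs) = -((fermiPoint u (θs + φ) - fermiPoint u θs) ⬝ᵥ dir θs)) ∧
        (∀ y ∈ Icc (-(s₁ / 4 * Φ)) (s₁ / 4 * Φ), HasDerivAt f (f' y) y ∧ HasDerivAt f' (f'' y) y ∧
          cf ≤ f'' y ∧ f'' y ≤ Af ∧ |f' y| ≤ Bf) ∧
        (∀ φ ∈ Icc (-Φ) Φ, ∀ φ' ∈ Icc (-Φ) Φ,
          s₁ / 2 * |φ - φ'| ≤ |(fermiPoint u (θs + φ) - fermiPoint u θs) ⬝ᵥ tdir θs - (fermiPoint u (θs + φ') - fermiPoint u θs) ⬝ᵥ tdir θs| ∧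
          |(fermiPoint u (θs + φ) - fermiPoint u θs) ⬝ᵥ tdir θs - (fermiPoint u (θs + φ') - fermiPoint u θs) ⬝ᵥ tdir θs| ≤ M₁ * |φ - φ'|) ∧
        (fermiPoint u (θs + 0) - fermiPoint u θs) ⬝ᵥ tdir θs = 0 := by
  -- the radius and its derivatives
  set r : ℝ → ℝ := fun θ => u θ 0 with hr_def
  set r' : ℝ → ℝ := fun θ => radiusDeriv u θ 0 with hr'_def
  set r'' : ℝ → ℝ := fun θ => radiusDeriv₂ u θ 0 with hr''_def
  have hsmooth : ContDiff ℝ ((⊤ : ℕ∞) : WithTop ℕ∞) r := contDiff_fermiRadius hD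
  have hr'eq : r' = deriv r := by
    funext θ; rw [hr'_def, hr_def]; simp only [radiusDeriv]
  have hsmooth' : ContDiff ℝ ((⊤ : ℕ∞) : WithTop ℕ∞) r' := by
    rw [hr'eq]; exact (contDiff_infty_iff_deriv.1 hsmooth).2
  have hr''eq : r'' = deriv r' := by
    funext θ; rw [hr''_def, hr'_def]; simp only [radiusDeriv₂]
  have hsmooth'' : ContDiff ℝ ((⊤ : ℕ∞) : WithTop ℕ∞) r'' := by
    rw [hr''eq]; exact (contDiff_infty_iff_deriv.1 hsmooth').2
  have hr : ∀ θ, HasDerivAt r (r' θ) θ := fun θ => by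
    rw [hr'eq]; exact ((hsmooth.differentiable (by simp)).differentiableAt).hasDerivAt
  have hr' : ∀ θ, HasDerivAt r' (r'' θ) θ := fun θ => by
    rw [hr''eq]; exact ((hsmooth'.differentiable (by simp)).differentiableAt).hasDerivAt
  -- periodicity and bounds
  have hper : Function.Periodic r (2 * π) := hD.periodic_u 0
  have hper' : Function.Periodic r' (2 * π) := by rw [hr'eq]; exact periodic_deriv' hper
  have hper'' : Function.Periodic r'' (2 * π) := by rw [hr''eq]; exact periodic_deriv' hper'
  obtain ⟨R₀, hR₀, hrb⟩ := periodic_bound' hsmooth.continuous hper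
  obtain ⟨R₁, hR₁, hr'b⟩ := periodic_bound' hsmooth'.continuous hper'
  obtain ⟨R₂, hR₂, hr''b⟩ := periodic_bound' hsmooth''.continuous hper''
  -- radius floor and curvature floor
  obtain ⟨cu, hcu, hupos⟩ := hD.u_pos
  obtain ⟨cκ, hcκ, hconv⟩ := hD.convex
  have h0 : |(0 : ℝ)| ≤ e₀ := by rw [abs_zero]; exact hD.e₀_pos.le
  have hD₀ : 0 < cκ * cu ^ 3 := by positivity
  have hD : ∀ θ, cκ * cu ^ 3 ≤ r θ ^ 2 + 2 * r' θ ^ 2 - r θ * r'' θ := fun θ =>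
    curvatureNumerator_ge_of_dispersionHyp hD hcκ hconv hcu hupos θ
  -- the window
  set s₁ : ℝ := cu with hs₁_def
  have hs₁ : 0 < s₁ := hcu
  set Φ : ℝ := s₁ / 2 / (R₀ + 2 * R₁ + R₂ + 1) with hΦ_def
  have hK : 0 < R₀ + 2 * R₁ + R₂ + 1 := by positivity
  have hΦ : 0 < Φ := by rw [hΦ_def]; positivity
  have hΦM : Φ * (R₀ + 2 * R₁ + R₂) ≤ s₁ / 2 := by
    rw [hΦ_def, div_mul_eq_mul_div, div_le_iff₀ hK]
    nlinarith [hs₁.le]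
  -- the constants
  refine ⟨s₁, Φ, cκ * cu ^ 3 / (R₀ + R₁) ^ 3, 8 * (R₀ ^ 2 + 2 * R₁ ^ 2 + R₀ * R₂) / s₁ ^ 3, 2 * (R₀ + R₁) / s₁, R₀ + R₁,
    hs₁, ?_, hΦ, ?_, ?_, by positivity, ?_⟩
  · -- `s₁ ≤ M₁`
    have h1 := hupos 0 0 h0
    have h2 := (le_abs_self _).trans (hrb 0)
    rw [hs₁_def]; rw [hr_def] at h2; simp only at h2; linarith
  · -- `0 < c_f`
    have h1 := hupos 0 0 h0
    have h2 := (le_abs_self _).trans (hrb 0)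
    have : 0 < R₀ + R₁ := by rw [hr_def] at h2; simp only at h2; linarith
    positivity
  · -- `c_f ≤ A_f`: from the chart at `θ⋆ = 0`
    have hframe : s₁ ≤ r' 0 * Real.sin (0 - 0) + r 0 * Real.cos (0 - 0) := by
      rw [sub_self, Real.sin_zero, Real.cos_zero, mul_zero, zero_add, mul_one, hs₁_def]
      exact hupos 0 0 h0
    obtain ⟨-, -, -, -, -, -, hcA, -⟩ := exists_polar_graph hr hr' hD₀ hrb hr'b hr''b hD 0 0 hs₁ hΦ hframe hΦM
    exact hcA.2
  · -- the chart at every base angle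
    intro θs
    have hframe : s₁ ≤ r' θs * Real.sin (θs - θs) + r θs * Real.cos (θs - θs) := by
      rw [sub_self, Real.sin_zero, Real.cos_zero, mul_zero, zero_add, mul_one, hs₁_def]
      exact hupos θs 0 h0
    obtain ⟨f, f', f'', hfm, hval, hder, -, hlip, hU0⟩ :=
      exists_polar_graph hr hr' hD₀ hrb hr'b hr''b hD θs θs hs₁ hΦ hframe hΦM
    refine ⟨f, f', f'', hfm, ?_, hder, ?_, ?_⟩
    · intro φ hφ
      rw [fermiPoint_eq_smul_dir, fermiPoint_eq_smul_dir]
      exact hval φ hφ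
    · intro φ hφ φ' hφ'
      rw [fermiPoint_eq_smul_dir, fermiPoint_eq_smul_dir, fermiPoint_eq_smul_dir]
      exact hlip φ hφ φ' hφ'
    · rw [fermiPoint_eq_smul_dir, fermiPoint_eq_smul_dir]
      exact hU0

end Summit.HubbardSuperconductivity.HubbardSuperconductivity.Theorems.ThinLevelSet

end
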